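import Literature.Computability.QuantumComplexity.PPPostBQPCore
import HarnessLib

/-!
# The Hadamard test of a `#P` count as one Clifford+`T` amplitude

Topic `Literature/Computability/QuantumComplexity`, sub-namespace `SharpPHT`; fourth support file for
the discharge of `MehrabanTahmasbi2024_PSharpP_subset_PPoly_of_stabilizerRank_poly`
(`StabilizerRankPermanent.lean`). Mehraban–Tahmasbi (arXiv:2305.10277, proof of Thm. 1.6, p. 5)
start from the Hadamard-test identity

  `⟨0ⁿ 1| H^{⊗ n+1} U_f (H^{⊗ n} ⊗ 1) |0^{n+1}⟩ = gap(f) / (√2 · 2ⁿ)`,   `U_f : |x⟩|0⟩ ↦ |x⟩|f(x)⟩` reversible,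

for a polynomial-size classical circuit `f`. Here it is realised, for the witness-counting function
of a `#P` relation `R ∈ P` with witness-length polynomial `p`, by an explicit ORACLE-FREE Clifford+`T`
circuit on the tree's registers, following the layout of the quantum core of the tree's proof of
`PP ⊆ PostBQP` (`PPPostBQPCore.lean`, `PPPostBQPCoreAmplitude.lean`; Aaronson 2005, Thm. 4): on input
`x` (wires `0 … n-1`, `n = |x|`),

1. a Hadamard gate on each of the `ρ = p(n)` witness wires `n … n+ρ-1`;
2. the exact Clifford+`T` compilation (`revCompile`) of the garbage-free reversible block
   (`RevClean.cleanOps`, Bennett's compute–copy–uncompute over the tableau of a polynomial-time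
   machine `M`) of the indicator function `chiF R p : x w 1 0 1^{2n} ↦ [⟨x, w⟩ ∈ R]`, which writes the
   one-hot read-out of the answer bit into the result zone and restores every other work wire;
3. a Hadamard gate on each witness wire again and on each code wire of the answer cell.

The amplitude of the label `yfin x` (input `x`, witnesses `0`, a `1` exactly on the `true`-code wire of
the answer cell, the constant classical values elsewhere) is then

  `(1/√2)^{ρ + |S₂|} · (2^ρ - 2 · #{w ∈ {0,1}^ρ | ⟨x, w⟩ ∈ R})`      (`runOn_circ_yfin`),

`S₂` the wires of the final Hadamard layer — i.e. `(1/√2)^{ρ+|S₂|} · gap`, the tree's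
`countWitnesses R ρ x` entering affinely.

* `chiF`, `chiF_apply`, `chiF_mem_FP` — the indicator brick and its machine (`exists_core`);
* `Core` (parameters), the layout (`rho`, `n0`, `nT`, `W`, `anc`, `resStart`, `resLen = A₁`), the
  program/circuit (`prog`, `clamp`, `circ`, oracle-freeness), the classical stage (`ins`, `sigma`,
  `sigma_apply`, `sigma_tWire`), the amplitude of a label (`runOn_circ_apply`), and the label `yfin`
  with **`runOn_circ_yfin`**.

## References

* S. Mehraban, M. Tahmasbi, arXiv:2305.10277 (STOC 2024), proof of Thm. 1.6 (the Hadamard test).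
* S. Aaronson, *Quantum computing, postselection, and probabilistic polynomial-time*, Proc. R. Soc.
  A 461 (2005), Thm. 4 (proof: "prepare `2^{-n/2} Σ_x |x⟩|f(x)⟩`, apply Hadamards, …").
* M. A. Nielsen, I. L. Chuang, *Quantum Computation and Quantum Information*, CUP 2010, §1.4.4
  eq. (1.50) (`H^{⊗k}` as a character sum), §3.2.5 (uncomputation).
-/

noncomputable section

namespace Literature.Computability.QuantumComplexity

namespace SharpPHT

open Complexity Complexity.Brick Complexity.Plumb Cryptography RevSim RevClean CWrap PPPostBQP _root_.Computability
  Matrix Finset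
open PPPostBQP.Core (hGates hGates_isOracleFree toMatrix_hGates)

/-! ### The indicator brick -/

/-- The witness part `w = (d ⇂ n) ↾ p(n)` of the block input `u = x ++ w ++ vg n` (`d = x ++ w`,
`n` read off the suffix in unary). [folklore] -/
def wF (p : Polynomial ℕ) : List Bool → List Bool :=
  takeFn ∘ fanoutFn (polyFn p ∘ nUF) (dropFn ∘ fanoutFn nUF dF)

/-- **The indicator brick** `chiF R p : x ++ w ++ vg |x| ↦ [⟨x, w⟩ ∈ R]`. [cite: AroraBarak2009, Def. 1.13] -/
def chiF (R : Language Bool) (p : Polynomial ℕ) : List Bool → List Bool := indPairF R xF (wF p)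

/-- Value of the witness part. [folklore] -/
theorem wF_apply (p : Polynomial ℕ) (x r : List Bool) : wF p (x ++ r ++ vg x.length) = r.take (p.eval x.length) := by
  obtain ⟨hn, hd, -⟩ := PPPostBQP.parse_input x r
  simp only [wF, Function.comp_apply, fanoutFn_apply, hn, hd, polyFn_apply, ones, List.length_replicate,
    dropFn_boolPair, takeFn_boolPair, List.drop_left]

/-- **Value of the indicator brick** on a well-formed block input with `|r| = p(|x|)`. [folklore] -/
theorem chiF_apply (R : Language Bool) (p : Polynomial ℕ) (x r : List Bool) (hr : r.length = p.eval x.length) :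
    chiF R p (x ++ r ++ vg x.length) = [R.boolIndicator (boolPair x r)] := by
  rw [chiF, indPairF_apply, wF_apply, (PPPostBQP.parse_input x r).2.2, List.take_of_length_le (by rw [hr])]

/-- `wF p ∈ FP`. [folklore] -/
theorem wF_mem_FP (p : Polynomial ℕ) : wF p ∈ FP :=
  comp_mem_FP takeFn_mem_FP (fanoutFn_mem_FP (comp_mem_FP (polyFn_mem_FP _) nUF_mem_FP)
    (comp_mem_FP dropFn_mem_FP (fanoutFn_mem_FP nUF_mem_FP dF_mem_FP)))

/-- **`chiF R p ∈ FP`** for `R ∈ P`. [cite: AroraBarak2009, Def. 1.13] -/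
theorem chiF_mem_FP {R : Language Bool} (hR : R ∈ Classes.P) (p : Polynomial ℕ) : chiF R p ∈ FP :=
  indPairF_mem_FP hR (comp_mem_FP takeFn_mem_FP (fanoutFn_mem_FP nUF_mem_FP dF_mem_FP)) (wF_mem_FP p)

/-! ### Parameters and layout -/

/-- **Parameters of the Hadamard-test core**: a `#P` relation `R` with witness polynomial `p`, and a
machine `M` computing `chiF R p` within `(n+2)^e` steps. [cite: Aaronson2005, Thm. 4 (proof)] -/
structure Core where
  /-- the witness relation -/
  R : Language Bool
  /-- the witness-length polynomial -/
  p : Polynomial ℕ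
  /-- time exponent of the machine -/
  e : ℕ
  /-- the machine of the indicator function -/
  M : Turing.TM2ComputableAux Bool Bool
  /-- it computes `chiF R p` within `(n+2)^e` steps -/
  hM : ∀ u : List Bool, M.OutputsWithin u (chiF R p u) (Tn e u.length)

/-- Parameters exist for every `R ∈ P`. [cite: AroraBarak2009, §1.3] -/
theorem exists_core {R : Language Bool} (hR : R ∈ Classes.P) (p : Polynomial ℕ) : ∃ Q : Core, Q.R = R ∧ Q.p = p := by
  obtain ⟨e, M, hM⟩ := exists_outputsWithin_pow_of_mem_FP (chiF_mem_FP hR p)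
  exact ⟨⟨R, p, e, M, hM⟩, rfl, rfl⟩

namespace Core

variable (Q : Core)

/-- Number of witness (coin) wires `ρ = p(n)`. [folklore] -/
def rho (n : ℕ) : ℕ := Q.p.eval n

/-- Number of data wires: input and witnesses. [folklore] -/
def n0 (n : ℕ) : ℕ := n + Q.rho n

/-- Tableau input length: data and the format suffix `vg n`. [folklore] -/
def nT (n : ℕ) : ℕ := Q.n0 n + (vg n).length

/-- Total number of wires. [folklore] -/
def W (n : ℕ) : ℕ := width Q.e Q.M (Q.nT n)

/-- The ancilla count. [folklore] -/
def anc (n : ℕ) : ℕ := Q.W n - n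

/-- Start of the result zone. [folklore] -/
def resStart (n : ℕ) : ℕ := NN Q.e Q.M (Q.nT n)

/-- Length of the Hadamard-ed result zone: the `A₁` code wires of the answer cell. [folklore] -/
def resLen (_n : ℕ) : ℕ := A₁ Q.M

/-- `n ≤ W`. [folklore] -/
theorem n_le_W (n : ℕ) : n ≤ Q.W n := by
  unfold W
  refine le_trans ?_ ((le_NN (e := Q.e) (M := Q.M) _).trans (NN_le_width _))
  unfold nT n0; omega

/-- `n0 ≤ W`. [folklore] -/
theorem n0_le_W (n : ℕ) : Q.n0 n ≤ Q.W n := by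
  unfold W
  refine le_trans ?_ ((le_NN (e := Q.e) (M := Q.M) _).trans (NN_le_width _))
  unfold nT; omega

/-- `n + anc n = W n`. [folklore] -/
theorem n_add_anc (n : ℕ) : n + Q.anc n = Q.W n := by
  unfold anc; have := Q.n_le_W n; omega

/-- The register is nonempty. [folklore] -/
theorem W_pos (n : ℕ) : 0 < n + Q.anc n := by
  rw [n_add_anc]; unfold W
  refine lt_of_lt_of_le ?_ ((le_NN (e := Q.e) (M := Q.M) _).trans (NN_le_width _))
  unfold nT; rw [length_vg]; omega

/-- `nT ≤ resStart`. [folklore] -/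
theorem nT_le_resStart (n : ℕ) : Q.nT n ≤ Q.resStart n := le_NN _

/-! ### The program and the circuit -/

/-- **The reversible program**: the garbage-free block of `M` on the `n + ρ` data wires with suffix
`vg n`. [cite: Shor1997, §3 p.8] -/
def prog (n : ℕ) : List (ClOp ℕ) := cleanOps Q.e Q.M (Q.n0 n) (vg n)

/-- The program is well formed. [folklore] -/
theorem prog_wf (n : ℕ) : ∀ op ∈ Q.prog n, op.WF := cleanOps_wf

/-- The program uses wires below `n + anc n`. [folklore] -/
theorem prog_lt (n : ℕ) : ∀ op ∈ Q.prog n, ∀ i ∈ wiresOf op, i < n + Q.anc n := by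
  rw [n_add_anc]; exact cleanOps_lt

/-- The program re-indexed to `Fin (n + anc n)`. [cite: AroraBarak2009, §10.3.7 Lemma 10.10] -/
def clamp (n : ℕ) : List (RevOp (n + Q.anc n)) :=
  toRevList ((Q.prog n).map (ClOp.map (finOf (n + Q.anc n) (Q.W_pos n)))) fun op hop => by
    simp only [List.mem_map] at hop
    obtain ⟨op, hop, rfl⟩ := hop
    exact wf_map_finOf _ (Q.prog_lt n op hop) (Q.prog_wf n op hop)

/-- Semantics of the clamped program. [folklore] -/
theorem revEval_clamp (n : ℕ) (w : QReg (n + Q.anc n)) (q : Fin (n + Q.anc n)) :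
    revEval (Q.clamp n) w q = clEval (Q.prog n) (liftW w) q := by
  unfold clamp
  rw [revEval_toRevList, clEval_map_finOf_apply _ _ (Q.prog_lt n)]

/-- The wire with `ℕ`-index `i`. [folklore] -/
def wire (n i : ℕ) : Fin (n + Q.anc n) := finOf (n + Q.anc n) (Q.W_pos n) i

/-- Value of a valid wire. [folklore] -/
theorem val_wire {n i : ℕ} (hi : i < n + Q.anc n) : (Q.wire n i : ℕ) = i := val_finOf_of_lt _ hi

/-- The witness wires `n, …, n + ρ - 1`. [folklore] -/
def coinWires (n : ℕ) : List (Fin (n + Q.anc n)) := (List.range (Q.rho n)).map fun j => Q.wire n (n + j)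

/-- The result zone of the answer cell. [folklore] -/
def resWires (n : ℕ) : List (Fin (n + Q.anc n)) := (List.range (Q.resLen n)).map fun j => Q.wire n (Q.resStart n + j)

/-- The wires of the final Hadamard layer: witnesses again, and the result zone. [folklore] -/
def h2Wires (n : ℕ) : List (Fin (n + Q.anc n)) := Q.coinWires n ++ Q.resWires n

/-- **The circuit of the Hadamard-test core** on input length `n`. [cite: MehrabanTahmasbi2024, proof of Theorem 1.6] -/
def circ (n : ℕ) : QCircuit cliffordT (n + Q.anc n) :=
  ⟨hGates (Q.coinWires n) ++ (revCompile (Q.clamp n) ++ hGates (Q.h2Wires n))⟩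

/-- **The circuit is oracle-free.** [folklore] -/
theorem circ_isOracleFree (n : ℕ) : (Q.circ n).IsOracleFree := by
  intro g hg
  unfold circ at hg
  rcases List.mem_append.1 hg with h | h
  · exact hGates_isOracleFree _ g h
  · rcases List.mem_append.1 h with h | h
    · exact revCompile_isOracleFree _ g h
    · exact hGates_isOracleFree _ g h

/-! ### Bounds on the layout -/

/-- Witness wires fit. [folklore] -/
theorem coin_lt {n j : ℕ} (hj : j < Q.rho n) : n + j < n + Q.anc n := by
  rw [n_add_anc]; unfold W
  refine lt_of_lt_of_le ?_ ((le_NN (e := Q.e) (M := Q.M) _).trans (NN_le_width _))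
  unfold nT n0; omega

/-- The block input of length `nT n` made of zeros and the suffix. [folklore] -/
theorem length_block (n : ℕ) (r : List Bool) (hr : r.length = Q.rho n) :
    (List.replicate n false ++ r ++ vg (List.replicate n false).length).length = Q.nT n := by
  simp only [List.length_append, List.length_replicate, length_vg, nT, n0, hr]

/-- The output word has length `1 < JJ`. [folklore] -/
theorem one_lt_JJ (n : ℕ) : 1 < JJ Q.e Q.M (Q.nT n) := by
  set u : List Bool := List.replicate n false ++ List.replicate (Q.rho n) false ++ vg (List.replicate n false).length
    with hu
  have hul : u.length = Q.nT n := Q.length_block n _ (List.length_replicate)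
  have hM := Q.hM u
  rw [hul] at hM
  have h := (length_lt_JJ_of_outputsWithin (e := Q.e) hul hM).1
  rwa [hu, chiF_apply _ _ _ _ (by simp [rho]), List.length_singleton] at h

/-- The result zone fits. [folklore] -/
theorem resStart_add_resLen_le (n : ℕ) : Q.resStart n + Q.resLen n ≤ Q.W n := by
  have hK := Q.one_lt_JJ n
  unfold resStart resLen W width copyN
  have := Nat.mul_le_mul_right (A₁ Q.M) hK.le
  omega

/-- Result-zone wires fit. [folklore] -/
theorem res_lt {n j : ℕ} (hj : j < Q.resLen n) : Q.resStart n + j < n + Q.anc n := by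
  rw [n_add_anc]; have := Q.resStart_add_resLen_le n; omega

/-- The witness wires are pairwise distinct. [folklore] -/
theorem coinWires_nodup (n : ℕ) : (Q.coinWires n).Nodup := by
  refine (List.nodup_range.map_on ?_)
  intro a ha b hb h
  have h' := congrArg Fin.val h
  rw [Q.val_wire (Q.coin_lt (List.mem_range.1 ha)), Q.val_wire (Q.coin_lt (List.mem_range.1 hb))] at h'
  omega

/-- The wires of the final layer are pairwise distinct. [folklore] -/
theorem h2Wires_nodup (n : ℕ) : (Q.h2Wires n).Nodup := by
  refine List.Nodup.append (Q.coinWires_nodup n) ?_ ?_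
  · refine List.nodup_range.map_on fun a ha b hb' h => ?_
    have h' := congrArg Fin.val h
    rw [Q.val_wire (Q.res_lt (List.mem_range.1 ha)), Q.val_wire (Q.res_lt (List.mem_range.1 hb'))] at h'
    omega
  · intro w hw hw'
    simp only [coinWires, resWires, List.mem_map, List.mem_range] at hw hw'
    obtain ⟨a, ha, rfl⟩ := hw
    obtain ⟨b, hb', h⟩ := hw'
    have h' := congrArg Fin.val h
    rw [Q.val_wire (Q.res_lt hb'), Q.val_wire (Q.coin_lt ha)] at h'
    have h1 : n + Q.rho n ≤ Q.resStart n := by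
      have := Q.nT_le_resStart n; unfold nT n0 at this; omega
    omega

/-! ### The classical stage -/

section Classical

variable {Q}
variable (x : List Bool)

/-- The basis label with input `x`, witnesses `r` and zeros elsewhere. [folklore] -/
def ins (r : Fin (Q.rho x.length) → Bool) : QReg (x.length + Q.anc x.length) := fun q =>
  if h : (q : ℕ) < x.length then x.get ⟨q, h⟩
  else if h' : (q : ℕ) < x.length + Q.rho x.length then r ⟨q - x.length, by omega⟩ else false

/-- `ins x r`, extended to `ℕ`, is the string `x ++ r` followed by zeros. [folklore] -/
theorem liftW_ins (r : Fin (Q.rho x.length) → Bool) : liftW (ins x r) = strW (x ++ List.ofFn r) := by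
  funext i
  unfold liftW strW ins
  by_cases hi : i < x.length + Q.anc x.length
  · rw [dif_pos hi]
    simp only
    by_cases hix : i < x.length
    · rw [dif_pos hix, List.getD_append _ _ _ _ hix, List.getD_eq_getElem _ _ hix]; rfl
    · rw [dif_neg hix]
      by_cases hir : i < x.length + Q.rho x.length
      · rw [dif_pos hir, List.getD_append_right _ _ _ _ (Nat.not_lt.1 hix),
          List.getD_eq_getElem _ _ (by simp; omega), List.getElem_ofFn]
      · rw [dif_neg hir, List.getD_eq_default _ _ (by simp; omega)]
  · have h1 := Q.n0_le_W x.length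
    rw [← Q.n_add_anc] at h1
    unfold n0 at h1
    rw [dif_neg hi, List.getD_eq_default _ _ (by simp; omega)]

/-- **The label after the compiled block** on `ins x r`. [folklore] -/
def sigma (r : Fin (Q.rho x.length) → Bool) : QReg (x.length + Q.anc x.length) := revEval (Q.clamp x.length) (ins x r)

/-- The answer bit on witnesses `r`. [folklore] -/
def bit (r : Fin (Q.rho x.length) → Bool) : Bool := Q.R.boolIndicator (boolPair x (List.ofFn r))

/-- The output word of the machine on the block input with witnesses `r`. [folklore] -/
def outWord (r : Fin (Q.rho x.length) → Bool) : List Bool := chiF Q.R Q.p (x ++ List.ofFn r ++ vg x.length)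

/-- The output word is the answer bit. [folklore] -/
theorem outWord_eq (r : Fin (Q.rho x.length) → Bool) : outWord x r = [bit x r] :=
  chiF_apply _ _ x _ (by simp [rho])

/-- The machine halts with the output word within the time bound, on the tableau input. [folklore] -/
theorem hM_outWord (r : Fin (Q.rho x.length) → Bool) :
    Q.M.OutputsWithin ((x ++ List.ofFn r) ++ vg x.length) (outWord x r)
      (Tn Q.e ((x ++ List.ofFn r).length + (vg x.length).length)) := by
  have h := Q.hM ((x ++ List.ofFn r) ++ vg x.length)
  rwa [List.length_append] at h

/-- Length of the tableau input. [folklore] -/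
theorem length_tabInput (r : Fin (Q.rho x.length) → Bool) :
    ((x ++ List.ofFn r) ++ vg x.length).length = Q.nT x.length := by
  simp only [List.length_append, List.length_ofFn, length_vg, nT, n0, rho]

/-- **Semantics of the classical stage**: data wires keep `x ++ r`, the other wires hold the read-out
of the output word. [cite: Shor1997, §3 p.8 (compute F(x) keeping x, copy, undo)] -/
theorem sigma_apply (r : Fin (Q.rho x.length) → Bool) (q : Fin (x.length + Q.anc x.length)) :
    sigma x r q = if (q : ℕ) < Q.n0 x.length then (x ++ List.ofFn r).getD q false
      else readOut Q.e Q.M (Q.nT x.length) (outWord x r) q := by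
  unfold sigma
  rw [revEval_clamp, liftW_ins]
  have h := clEval_cleanOps (e := Q.e) (M := Q.M) (x ++ List.ofFn r) (vg x.length) (outWord x r) (hM_outWord x r)
  have hlen : (x ++ List.ofFn r).length = Q.n0 x.length := by simp [n0, rho]
  rw [hlen] at h
  unfold prog
  rw [h]
  rfl

/-- Below the data the label reads the data. [folklore] -/
theorem sigma_apply_of_lt (r : Fin (Q.rho x.length) → Bool) {q : Fin (x.length + Q.anc x.length)}
    (hq : (q : ℕ) < Q.n0 x.length) : sigma x r q = (x ++ List.ofFn r).getD q false := by
  rw [sigma_apply, if_pos hq]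

/-- The `true`-code wire of the answer cell. [folklore] -/
def tWire (Q : Core) (n : ℕ) : Fin (n + Q.anc n) := Q.wire n (resW Q.e Q.M (Q.nT n) 0 (symTrue Q.M))

/-- The result zone contains the code wires of the answer cell. [folklore] -/
theorem resW_lt_zero (a : OSym Q.M) :
    Q.resStart x.length ≤ resW Q.e Q.M (Q.nT x.length) 0 a ∧
      resW Q.e Q.M (Q.nT x.length) 0 a < Q.resStart x.length + Q.resLen x.length := by
  unfold resStart resLen resW
  have h1 : (eA Q.M a : ℕ) < A₁ Q.M := (eA Q.M a).isLt
  constructor <;> omega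

/-- Value of `tWire`. [folklore] -/
theorem val_tWire : (tWire Q x.length : ℕ) = resW Q.e Q.M (Q.nT x.length) 0 (symTrue Q.M) :=
  Q.val_wire (by
    rw [Q.n_add_anc]
    have := resW_lt_zero x (symTrue Q.M)
    have := Q.resStart_add_resLen_le x.length
    omega)

/-- The machine halts with the output word within `Tn e (nT n)` steps on the tableau input. [folklore] -/
theorem hM_outWord' (r : Fin (Q.rho x.length) → Bool) :
    Q.M.OutputsWithin ((x ++ List.ofFn r) ++ vg x.length) (outWord x r) (Tn Q.e (Q.nT x.length)) := by
  have h := Q.hM ((x ++ List.ofFn r) ++ vg x.length)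
  rwa [length_tabInput] at h

/-- **The `true`-code wire of the answer cell reads the answer bit.** [folklore] -/
theorem sigma_tWire (r : Fin (Q.rho x.length) → Bool) : sigma x r (tWire Q x.length) = bit x r := by
  have hM := hM_outWord' x r
  have hge : ¬ ((tWire Q x.length : Fin _) : ℕ) < Q.n0 x.length := by
    rw [val_tWire]
    have h1 := Q.nT_le_resStart x.length
    have h2 := NN_le_resW (e := Q.e) (M := Q.M) (Q.nT x.length) 0 (symTrue Q.M)
    have h3 : Q.n0 x.length ≤ Q.nT x.length := Nat.le_add_right _ _
    unfold resStart at h1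
    omega
  rw [sigma_apply, if_neg hge, val_tWire, readOut_resW (Q.one_lt_JJ x.length).le,
    outBit_symTrue_eq (e := Q.e) (length_tabInput x r) hM (by rw [outWord_eq]; exact Nat.zero_lt_one)]
  simp [outWord_eq]

end Classical

/-! ### The amplitude of a label -/

section Amplitude

variable {Q}
variable (x : List Bool)

/-- The witnesses read off a label. [folklore] -/
def coinsOf (z : QReg (x.length + Q.anc x.length)) : Fin (Q.rho x.length) → Bool :=
  fun j => z (Q.wire x.length (x.length + j))

/-- The witness wire `j`, as a valid index. [folklore] -/
theorem val_coinWire (j : Fin (Q.rho x.length)) : (Q.wire x.length (x.length + j) : ℕ) = x.length + j :=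
  Q.val_wire (Q.coin_lt j.isLt)

/-- Membership in the witness wires, by value. [folklore] -/
theorem mem_coinWires_iff (q : Fin (x.length + Q.anc x.length)) :
    q ∈ Q.coinWires x.length ↔ x.length ≤ (q : ℕ) ∧ (q : ℕ) < x.length + Q.rho x.length := by
  simp only [coinWires, List.mem_map, List.mem_range]
  constructor
  · rintro ⟨j, hj, rfl⟩; rw [Q.val_wire (Q.coin_lt hj)]; omega
  · rintro ⟨h1, h2⟩
    refine ⟨q - x.length, by omega, Fin.ext ?_⟩
    rw [Q.val_wire (Q.coin_lt (by omega))]; omega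

/-- Entries of `ins`. [folklore] -/
theorem ins_apply (r : Fin (Q.rho x.length) → Bool) (q : Fin (x.length + Q.anc x.length)) :
    ins x r q = if h : (q : ℕ) < x.length then x.get ⟨q, h⟩
      else if h' : (q : ℕ) < x.length + Q.rho x.length then r ⟨q - x.length, by omega⟩ else false := rfl

/-- The witnesses of `ins x r` are `r`. [folklore] -/
theorem coinsOf_ins (r : Fin (Q.rho x.length) → Bool) : coinsOf x (ins x r) = r := by
  funext j
  simp only [coinsOf, ins_apply, val_coinWire]
  rw [dif_neg (by omega), dif_pos (by omega)]
  congr 1; ext; simp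

/-- A wire in the witness range is a `coinWire`. [folklore] -/
theorem wire_add_sub (q : Fin (x.length + Q.anc x.length)) (h1 : x.length ≤ (q : ℕ))
    (h2 : (q : ℕ) < x.length + Q.rho x.length) : Q.wire x.length (x.length + ((q : ℕ) - x.length)) = q := by
  apply Fin.ext; rw [Q.val_wire (Q.coin_lt (by omega))]; omega

/-- `ins x r = z` iff `z` agrees with the padded input off the witness wires and has witnesses `r`.
[folklore] -/
theorem ins_eq_iff (r : Fin (Q.rho x.length) → Bool) (z : QReg (x.length + Q.anc x.length)) :
    ins x r = z ↔ (∀ q, q ∉ Q.coinWires x.length → z q = padInput x.get (Q.anc x.length) q) ∧ coinsOf x z = r := by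
  constructor
  · rintro rfl
    refine ⟨fun q hq => ?_, coinsOf_ins x r⟩
    rw [mem_coinWires_iff] at hq
    rw [ins_apply, ← liftW_val (padInput x.get (Q.anc x.length)) q, liftW_padInput_get]
    unfold strW
    by_cases h : (q : ℕ) < x.length
    · rw [dif_pos h, List.getD_eq_getElem _ _ h]; rfl
    · rw [dif_neg h, dif_neg (fun h' => hq ⟨Nat.not_lt.1 h, h'⟩), List.getD_eq_default _ _ (Nat.not_lt.1 h)]
  · rintro ⟨hagree, rfl⟩
    funext q
    rw [ins_apply]
    by_cases h : (q : ℕ) < x.length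
    · rw [dif_pos h, hagree q (fun hq => by rw [mem_coinWires_iff] at hq; omega),
        ← liftW_val (padInput x.get (Q.anc x.length)) q, liftW_padInput_get]
      unfold strW; rw [List.getD_eq_getElem _ _ h]; rfl
    · rw [dif_neg h]
      by_cases h' : (q : ℕ) < x.length + Q.rho x.length
      · rw [dif_pos h']
        show z (Q.wire x.length (x.length + ((q : ℕ) - x.length))) = z q
        rw [wire_add_sub x q (Nat.not_lt.1 h) h']
      · rw [dif_neg h', hagree q (fun hq => by rw [mem_coinWires_iff] at hq; omega),
          ← liftW_val (padInput x.get (Q.anc x.length)) q, liftW_padInput_get]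
        unfold strW; rw [List.getD_eq_default _ _ (by omega)]

/-- **The first Hadamard layer prepares the uniform superposition over the witnesses.**
[cite: NielsenChuang2010, §1.4.4 eq. (1.50)] -/
theorem stage1_eq_sum :
    (⟨hGates (Q.coinWires x.length)⟩ : QCircuit cliffordT (x.length + Q.anc x.length)).toMatrix 0 *ᵥ
        basisState (padInput x.get (Q.anc x.length)) =
      ∑ r : Fin (Q.rho x.length) → Bool, (invSqrt2 ^ Q.rho x.length) • basisState (ins x r) := by
  rw [hGates, hadamards_mulVec_basisState _ (Q.coinWires_nodup x.length) _ (fun q hq => by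
    rw [mem_coinWires_iff] at hq
    rw [← liftW_val (padInput x.get (Q.anc x.length)) q, liftW_padInput_get]
    exact List.getD_eq_default _ _ hq.1)]
  funext z
  rw [Finset.sum_apply]
  simp only [Pi.smul_apply, basisState_apply, smul_eq_mul, mul_ite, mul_one, mul_zero]
  have hlen : (Q.coinWires x.length).length = Q.rho x.length := by simp [coinWires]
  rw [hlen]
  simp_rw [eq_comm (a := z), ins_eq_iff x]
  by_cases hag : ∀ q, q ∉ Q.coinWires x.length → z q = padInput x.get (Q.anc x.length) q
  · rw [if_pos hag, Finset.sum_eq_single (coinsOf x z) (fun r _ hr => if_neg fun h => hr h.2.symm)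
      (fun h => absurd (Finset.mem_univ _) h), if_pos ⟨hag, rfl⟩]
  · rw [if_neg hag]
    exact (Finset.sum_eq_zero fun r _ => if_neg fun h => hag h.1).symm

/-- The wires of the final Hadamard layer, as a set. [folklore] -/
def S2 (Q : Core) (n : ℕ) : Finset (Fin (n + Q.anc n)) := (Q.h2Wires n).toFinset

/-- **The amplitude of a label** after the whole circuit. [cite: NielsenChuang2010, §2.2.5] -/
theorem runOn_circ_apply (y : QReg (x.length + Q.anc x.length)) :
    (Q.circ x.length).runOn 0 (basisState (padInput x.get (Q.anc x.length))) y =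
      ∑ r : Fin (Q.rho x.length) → Bool,
        invSqrt2 ^ Q.rho x.length * BGK.hLayerMatrix (S2 Q x.length) y (sigma x r) := by
  have hc : Q.circ x.length = ((⟨hGates (Q.coinWires x.length)⟩ : QCircuit cliffordT _).append
      ((⟨revCompile (Q.clamp x.length)⟩ : QCircuit cliffordT _).append ⟨hGates (Q.h2Wires x.length)⟩)) := rfl
  rw [QCircuit.runOn, hc, QCircuit.toMatrix_append, QCircuit.toMatrix_append, ← Matrix.mulVec_mulVec,
    stage1_eq_sum, Matrix.mulVec_sum, Finset.sum_apply]
  refine Finset.sum_congr rfl fun r _ => ?_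
  rw [Matrix.mulVec_smul, ← Matrix.mulVec_mulVec, revCompile_mulVec_basisState,
    toMatrix_hGates _ _ (Q.h2Wires_nodup x.length), Pi.smul_apply, mulVec_basisState, smul_eq_mul]
  rfl

/-- Membership in the final layer, by value: witness wires or result zone. [folklore] -/
theorem mem_S2_iff (q : Fin (x.length + Q.anc x.length)) :
    q ∈ S2 Q x.length ↔ (x.length ≤ (q : ℕ) ∧ (q : ℕ) < x.length + Q.rho x.length) ∨
      (Q.resStart x.length ≤ (q : ℕ) ∧ (q : ℕ) < Q.resStart x.length + Q.resLen x.length) := by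
  simp only [S2, List.mem_toFinset, h2Wires, List.mem_append, resWires, List.mem_map, List.mem_range,
    mem_coinWires_iff]
  constructor
  · rintro (h | ⟨j, hj, rfl⟩)
    · exact Or.inl h
    · right; rw [Q.val_wire (Q.res_lt hj)]; omega
  · rintro (h | ⟨h1, h2⟩)
    · exact Or.inl h
    · right; refine ⟨q - Q.resStart x.length, by omega, Fin.ext ?_⟩
      rw [Q.val_wire (Q.res_lt (by omega))]; omega

/-- `tWire ∈ S₂`. [folklore] -/
theorem tWire_mem_S2 : tWire Q x.length ∈ S2 Q x.length := by
  rw [mem_S2_iff]; right; rw [val_tWire x]; exact resW_lt_zero x _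

/-- The read-out of a cell beyond the output word is a constant. [folklore] -/
theorem outBit_of_length_le {l' : List Bool} {j : ℕ} (hj : l'.length ≤ j) (a : OSym Q.M) :
    outBit Q.M l' j a = decide (none = a) := by
  unfold outBit
  rw [cellVal_haltList_of_le hj]

/-- **Off the result zone, the read-outs of two one-bit output words agree.** [folklore] -/
theorem readOut_eq_of_not_mem {l₁ l₂ : List Bool} (h₁ : l₁.length = 1) (h₂ : l₂.length = 1)
    {i : ℕ} (hi : ¬ (Q.resStart x.length ≤ i ∧ i < Q.resStart x.length + Q.resLen x.length)) :
    readOut Q.e Q.M (Q.nT x.length) l₁ i = readOut Q.e Q.M (Q.nT x.length) l₂ i := by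
  unfold readOut
  split_ifs with h
  · have hA := one_le_A₁ (M := Q.M)
    have hcell : 1 ≤ (i - NN Q.e Q.M (Q.nT x.length)) / A₁ Q.M := by
      by_contra hc
      apply hi
      unfold resStart resLen
      have := Nat.lt_of_div_lt_div (a := i - NN Q.e Q.M (Q.nT x.length)) (b := 1 * A₁ Q.M) (c := A₁ Q.M)
        (by rw [Nat.mul_div_cancel _ hA]; omega)
      omega
    rw [outBit_of_length_le (by omega), outBit_of_length_le (by omega)]
  · rfl

/-- **Any two witness strings give the same classical label off `S₂`.** [folklore] -/
theorem sigma_eq_of_not_mem_S2 (r r' : Fin (Q.rho x.length) → Bool) {q : Fin (x.length + Q.anc x.length)}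
    (hq : q ∉ S2 Q x.length) : sigma x r q = sigma x r' q := by
  rw [mem_S2_iff, not_or] at hq
  by_cases h0 : (q : ℕ) < Q.n0 x.length
  · rw [sigma_apply_of_lt x r h0, sigma_apply_of_lt x r' h0]
    have h1 : (q : ℕ) < x.length := by unfold n0 at h0; omega
    rw [List.getD_append _ _ _ _ h1, List.getD_append _ _ _ _ h1]
  · rw [sigma_apply, sigma_apply, if_neg h0, if_neg h0]
    exact readOut_eq_of_not_mem x (by rw [outWord_eq]; rfl) (by rw [outWord_eq]; rfl) hq.2

/-- **The final label**: a `1` exactly on the `true`-code wire of the answer cell among the wires of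
`S₂` (in particular witnesses `0`), and the constant classical values elsewhere.
[cite: MehrabanTahmasbi2024, proof of Theorem 1.6 (the projection ⟨0ⁿ1|)] -/
def yfin : QReg (x.length + Q.anc x.length) := fun q =>
  if q ∈ S2 Q x.length then decide (q = tWire Q x.length) else sigma x (fun _ => false) q

/-- `hCoef` through the integer sign: `⟨a|H|b⟩ = (1/√2) · (a ? (-1)^b : 1)`. [cite: NielsenChuang2010, §4.2] -/
theorem hCoef_eq (a b : Bool) : BGK.hCoef a b = invSqrt2 * (if a then ((sgn b : ℤ) : ℂ) else 1) := by
  cases a <;> cases b <;> simp [BGK.hCoef, sgn]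

/-- **The entry of the final Hadamard layer between the final label and a classical label** is
`(1/√2)^{|S₂|} (-1)^{bit(r)}`. [cite: NielsenChuang2010, §1.4.4 eq. (1.50)] -/
theorem hLayer_yfin_sigma (r : Fin (Q.rho x.length) → Bool) :
    BGK.hLayerMatrix (S2 Q x.length) (yfin x) (sigma x r) =
      invSqrt2 ^ (S2 Q x.length).card * ((sgn (bit x r) : ℤ) : ℂ) := by
  rw [BGK.hLayerMatrix_apply]
  have hag : ∀ q, q ∉ S2 Q x.length → yfin x q = sigma x r q := fun q hq => by
    simp only [yfin, hq, if_false]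
    exact sigma_eq_of_not_mem_S2 x _ _ hq
  rw [if_pos hag]
  have hy : ∀ q ∈ S2 Q x.length, yfin x q = decide (q = tWire Q x.length) := fun q hq => by simp [yfin, hq]
  rw [Finset.prod_congr rfl fun q hq => by rw [hy q hq, hCoef_eq], Finset.prod_mul_distrib, Finset.prod_const]
  congr 1
  simp only [decide_eq_true_eq]
  rw [← Finset.prod_filter, Finset.filter_eq' _ (tWire Q x.length), if_pos (tWire_mem_S2 x), Finset.prod_singleton,
    sigma_tWire]

/-- A count of witnesses over bit functions. [cite: AroraBarak2009, Def. 17.2] -/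
theorem countWitnesses_eq_card (R : Language Bool) (m : ℕ) (x : List Bool) [DecidablePred (· ∈ R)] :
    countWitnesses R m x =
      (Finset.univ.filter fun y : Fin m → Bool => boolPair x (List.ofFn y) ∈ R).card := by
  classical
  unfold countWitnesses
  convert Finset.card_equiv (Equiv.vectorEquivFin Bool m) (fun v => ?_)
  have e : List.ofFn v.get = v.toList := by rw [← List.Vector.toList_ofFn, List.Vector.ofFn_get]
  simp only [Finset.mem_filter, Finset.mem_univ, true_and, Equiv.vectorEquivFin, Equiv.coe_fn_mk, e]

/-- The character sum of the answer bits is the gap `2^ρ - 2 · #witnesses`. [cite: AroraBarak2009, §17.2.1 (gaps)] -/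
theorem sum_sgn_bit [DecidablePred (· ∈ Q.R)] :
    ∑ r : Fin (Q.rho x.length) → Bool, (sgn (bit x r) : ℤ) =
      (2 : ℤ) ^ Q.rho x.length - 2 * countWitnesses Q.R (Q.rho x.length) x := by
  rw [countWitnesses_eq_card]
  have hsplit := Finset.sum_filter_add_sum_filter_not Finset.univ
    (fun r : Fin (Q.rho x.length) → Bool => boolPair x (List.ofFn r) ∈ Q.R) (fun r => (sgn (bit x r) : ℤ))
  rw [← hsplit]
  have h1 : ∑ r ∈ Finset.univ.filter (fun r : Fin (Q.rho x.length) → Bool => boolPair x (List.ofFn r) ∈ Q.R),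
      (sgn (bit x r) : ℤ) = -(Finset.univ.filter fun r : Fin (Q.rho x.length) → Bool => boolPair x (List.ofFn r) ∈ Q.R).card := by
    rw [Finset.card_eq_sum_ones, Nat.cast_sum, ← Finset.sum_neg_distrib]
    refine Finset.sum_congr rfl fun r hr => ?_
    rw [Finset.mem_filter] at hr
    simp [bit, (Set.mem_iff_boolIndicator _ _).1 hr.2, sgn]
  have h2 : ∑ r ∈ Finset.univ.filter (fun r : Fin (Q.rho x.length) → Bool => ¬ boolPair x (List.ofFn r) ∈ Q.R),
      (sgn (bit x r) : ℤ) = (Finset.univ.filter fun r : Fin (Q.rho x.length) → Bool => ¬ boolPair x (List.ofFn r) ∈ Q.R).card := by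
    rw [Finset.card_eq_sum_ones, Nat.cast_sum]
    refine Finset.sum_congr rfl fun r hr => ?_
    rw [Finset.mem_filter] at hr
    simp [bit, (Set.notMem_iff_boolIndicator _ _).1 hr.2, sgn]
  rw [h1, h2]
  have hc := Finset.card_filter_add_card_filter_not (s := (Finset.univ : Finset (Fin (Q.rho x.length) → Bool)))
    (fun r => boolPair x (List.ofFn r) ∈ Q.R)
  rw [Finset.card_univ, Fintype.card_fun, Fintype.card_bool, Fintype.card_fin] at hc
  have hc' : ((Finset.univ.filter fun r : Fin (Q.rho x.length) → Bool => ¬ boolPair x (List.ofFn r) ∈ Q.R).card : ℤ) =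
      (2 : ℤ) ^ Q.rho x.length - (Finset.univ.filter fun r : Fin (Q.rho x.length) → Bool => boolPair x (List.ofFn r) ∈ Q.R).card := by
    have := congrArg (fun k : ℕ => (k : ℤ)) hc
    push_cast at this
    linarith
  rw [hc']
  ring

/-- **The Hadamard-test amplitude.** The amplitude of the final label is
`(1/√2)^{ρ + |S₂|} · (2^ρ - 2 · #{w | ⟨x, w⟩ ∈ R})`: the witness count of the `#P` relation enters
affinely into one amplitude of an explicit oracle-free Clifford+`T` circuit.
[cite: MehrabanTahmasbi2024, proof of Theorem 1.6 (⟨0ⁿ1|H U_f H|0^{n+1}⟩ = gap(f)/(√2 2ⁿ))] -/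
theorem runOn_circ_yfin :
    (Q.circ x.length).runOn 0 (basisState (padInput x.get (Q.anc x.length))) (yfin x) =
      invSqrt2 ^ Q.rho x.length * invSqrt2 ^ (S2 Q x.length).card *
        (((2 : ℤ) ^ Q.rho x.length - 2 * countWitnesses Q.R (Q.rho x.length) x : ℤ) : ℂ) := by
  classical
  rw [runOn_circ_apply, ← Finset.mul_sum, mul_assoc]
  congr 1
  simp_rw [hLayer_yfin_sigma]
  rw [← Finset.mul_sum, ← sum_sgn_bit x, Int.cast_sum]

end Amplitude

end Core

end SharpPHT

end Literature.Computability.QuantumComplexity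

end
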